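import Literature.AlgebraicGeometry.Motives.HirschowitzIyerStrongPlanes
import HarnessLib

/-!
# Hirschowitz–Iyer's surjectivity theorem for `V₊(Q, C) ⊂ V₊(Q)` at `r = 1`, reduced to Lemma 2.2 (`s = 0`)

Hirschowitz–Iyer, Contemp. Math. 522 (2010), §2, Theorem 2.1: if `Y = V₊(Q, C)` is covered by strong
lines, the restriction (Gysin) map `QCH₂(Y') → QCH₁(Y)` is onto (`Y' = V₊(Q)`). Its printed proof is a
descending induction on `s ∈ {2, 1, 0}` over the filtration `QCH₁^{(s)}(Y)` (classes of curves spanned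
by strong `s`-planes), with Lemma 2.2 as the induction step. For `r = 1` there are two steps:

* `s = 1` — strong lines are in the `ℚ`-image: **proved here** (`IsStrongLinePoint.exists_smul_mk_eq_gysin`)
  from the strong-planes computation `Γ · Y = a • [L]`, `a > 0` (`Motives/HirschowitzIyerStrongPlanes`),
  with the definitions `IsStrongPlanePoint` / `IsStrongLinePoint` transcribing HI's "strong
  `(r+1)`-plane" / "strong `r`-plane" for the pair;
* `s = 0` — every curve is, modulo strong lines, a positive rational multiple of some `Γ · Y`
  (Lemma 2.2 with `s = 0 < r = 1`: the one-parameter family of strong lines through the points of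
  the curve, a ruled surface): NOT in the tree; it enters as the hypothesis `hcurves` of

* `quadricCubicGysin_qsurjective_of_curves` — **Theorem 2.1 (`r = 1`) from Lemma 2.2 (`s = 0`)**: the
  bookkeeping of the induction (`ℚ`-saturation of the image is a subgroup containing all strong lines,
  hence all curves, hence everything, `CH₁(Y)` being generated by classes of curves).

Everything here is proved; no named facts.

## References

* A. Hirschowitz, J. N. Iyer, Contemp. Math. 522 (2010), §2, Theorem 2.1 and Lemma 2.2.
  [HirschowitzIyer2010]
-/

noncomputable section

universe u

open CategoryTheory AlgebraicGeometry Order Topology TopologicalSpace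
open Literature.AlgebraicGeometry.Motives.Segre Literature.AlgebraicGeometry.Motives.RatFn

attribute [local instance] MvPolynomial.gradedAlgebra

namespace Literature.AlgebraicGeometry.Motives

section

variable {n : ℕ} {K : Type u} [Field K] (Q C : MvPolynomial (Fin (n + 1)) K)

/-- **Strong `(r+1)`-plane of the pair `(V₊(Q, C), V₊(Q))`** (Hirschowitz–Iyer §2: "A `(r+1)`-plane `H`
in `Y'` is said strong if it is contained in `Y`, or if its set-theoretic intersection with `Y` is an
`r`-plane"), as a predicate on the generic point `w` of the plane `Π = closure {w} ⊆ V₊(Q)`: `Π` is an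
`(r+1)`-plane and either `Π ⊆ V₊(C)` or `Π ∩ V₊(C) = Π ∩ V₊(ℓ)` for a linear form `ℓ` not vanishing on
`Π`. [cite: HirschowitzIyer2010, §2 (strong planes)] -/
def IsStrongPlanePoint (r : ℕ) (w : ↥(quadric Q).left) : Prop :=
  IsLinearSubspacePoint (r + 1) n (completeIntersectionι (fun _ : Fin 1 => Q)) w ∧
    (closure {quadricι Q w} ⊆
        ProjectiveSpectrum.zeroLocus (MvPolynomial.homogeneousSubmodule (Fin (n + 1)) K) {C} ∨
      ∃ ℓ : MvPolynomial (Fin (n + 1)) K, ℓ ∈ grading (Fin (n + 1)) K 1 ∧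
        ℓ ∉ (quadricι Q w).asHomogeneousIdeal ∧
        closure {quadricι Q w} ∩
            ProjectiveSpectrum.zeroLocus (MvPolynomial.homogeneousSubmodule (Fin (n + 1)) K) {C} =
          closure {quadricι Q w} ∩
            ProjectiveSpectrum.zeroLocus (MvPolynomial.homogeneousSubmodule (Fin (n + 1)) K) {ℓ})

/-- **Strong `r`-plane of `Y = V₊(Q, C)`** (Hirschowitz–Iyer §1/§2: "an `r`-plane `L` in `Y` is said
strong if there exists an `(r+1)`-plane `L'` in `Y'` containing `L` such that the set-theoretic
intersection `L' ∩ Y` is either `L` or `L'`"), as a predicate on the generic point `v` of `L`: `L` is an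
`r`-plane of `V₊(Q, C)` contained in a strong `(r+1)`-plane of the pair.
[cite: HirschowitzIyer2010, §2 (strong planes)] -/
def IsStrongLinePoint (r : ℕ) (v : ↥(quadricCubic Q C).left) : Prop :=
  IsLinearSubspacePoint r n (completeIntersectionι ![Q, C]) v ∧
    ∃ w : ↥(quadric Q).left, IsStrongPlanePoint Q C r w ∧
      closure {quadricι Q ((quadricCubicToQuadric Q C).left v)} ⊆ closure {quadricι Q w}

variable {Q C}

/-- Unfolding of `IsStrongPlanePoint` (`Iff.rfl`). [folklore] -/
theorem isStrongPlanePoint_iff (r : ℕ) (w : ↥(quadric Q).left) :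
    IsStrongPlanePoint Q C r w ↔
      IsLinearSubspacePoint (r + 1) n (completeIntersectionι (fun _ : Fin 1 => Q)) w ∧
        (closure {quadricι Q w} ⊆
            ProjectiveSpectrum.zeroLocus (MvPolynomial.homogeneousSubmodule (Fin (n + 1)) K) {C} ∨
          ∃ ℓ : MvPolynomial (Fin (n + 1)) K, ℓ ∈ grading (Fin (n + 1)) K 1 ∧
            ℓ ∉ (quadricι Q w).asHomogeneousIdeal ∧
            closure {quadricι Q w} ∩
                ProjectiveSpectrum.zeroLocus (MvPolynomial.homogeneousSubmodule (Fin (n + 1)) K) {C} =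
              closure {quadricι Q w} ∩
                ProjectiveSpectrum.zeroLocus (MvPolynomial.homogeneousSubmodule (Fin (n + 1)) K) {ℓ}) :=
  Iff.rfl

/-- Unfolding of `IsStrongLinePoint` (`Iff.rfl`). [folklore] -/
theorem isStrongLinePoint_iff (r : ℕ) (v : ↥(quadricCubic Q C).left) :
    IsStrongLinePoint Q C r v ↔
      IsLinearSubspacePoint r n (completeIntersectionι ![Q, C]) v ∧
        ∃ w : ↥(quadric Q).left, IsStrongPlanePoint Q C r w ∧
          closure {quadricι Q ((quadricCubicToQuadric Q C).left v)} ⊆ closure {quadricι Q w} :=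
  Iff.rfl

end

/-! ### Planes of equal dimension, one inside the other, coincide -/

section Planes

variable {n : ℕ} {K : Type u} [Field K] {Q C : MvPolynomial (Fin (n + 1)) K}

/-- Two points of `V₊(Q, C)` of the same (finite) height whose closures in `ℙⁿ` are nested are equal.
[folklore] -/
theorem eq_of_closure_subset_of_height_eq {v v' : ↥(quadricCubic Q C).left} {r : ℕ}
    (hv : height v = r) (hv' : height v' = r)
    (hsub : closure {quadricι Q ((quadricCubicToQuadric Q C).left v)} ⊆
      closure {quadricι Q ((quadricCubicToQuadric Q C).left v')}) : v = v' := by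
  set j : ↥(quadricCubic Q C).left → ProjSpace.P n K :=
    fun x => quadricι Q ((quadricCubicToQuadric Q C).left x) with hj
  have hjemb : Topology.IsClosedEmbedding j :=
    (quadricι Q).isClosedEmbedding.comp (quadricCubicToQuadric Q C).left.isClosedEmbedding
  have hmem : j v ∈ closure {j v'} := hsub (subset_closure (Set.mem_singleton _))
  have hspec : j v' ⤳ j v := specializes_iff_mem_closure.2 (by simpa using hmem)
  have hspec' : v' ⤳ v := hjemb.isEmbedding.specializes_iff.1 hspec
  have hle : v ≤ v' := Scheme.le_iff_specializes.mpr hspec'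
  by_contra hne
  have hlt : v < v' := lt_of_le_not_ge hle fun hge =>
    hne (hspec'.antisymm (Scheme.le_iff_specializes.mp hge)).eq.symm
  have h1 := height_add_one_le hlt
  rw [hv, hv'] at h1
  exact absurd h1 (by norm_cast; omega)

/-- A line of `ℙⁿ` inside a plane is cut out of the plane by a linear form: for an `r`-plane point `v`
and an `(r+1)`-plane point `w` (both of `ℙⁿ`) with `closure {v} ⊆ closure {w}`, some linear form in
`𝔭_v` is not in `𝔭_w`. [folklore] -/
theorem exists_linear_mem_notMem {r : ℕ} {v w : ↥(projectiveSpace n K).left}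
    (hv : IsLinearSubspacePoint r n (𝟙 (projectiveSpace n K)) v)
    (hw : IsLinearSubspacePoint (r + 1) n (𝟙 (projectiveSpace n K)) w) :
    ∃ m : MvPolynomial (Fin (n + 1)) K, m ∈ grading (Fin (n + 1)) K 1 ∧
      m ∈ (ProjectiveSpectrum.asHomogeneousIdeal
        (𝒜 := MvPolynomial.homogeneousSubmodule (Fin (n + 1)) K) v) ∧
      m ∉ (ProjectiveSpectrum.asHomogeneousIdeal
        (𝒜 := MvPolynomial.homogeneousSubmodule (Fin (n + 1)) K) w) := by
  obtain ⟨L, hL, hhom, hcl, hspan, -⟩ := hv.exists_eq_span_of_id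
  by_contra! hall
  -- all the `L_j` lie in `𝔭_w`, so `𝔭_v ⊆ 𝔭_w`, i.e. `w ∈ closure {v}`: heights `r + 1 ≤ r`
  have hle : (ProjectiveSpectrum.asHomogeneousIdeal
      (𝒜 := MvPolynomial.homogeneousSubmodule (Fin (n + 1)) K) v).toIdeal ≤
      (ProjectiveSpectrum.asHomogeneousIdeal
        (𝒜 := MvPolynomial.homogeneousSubmodule (Fin (n + 1)) K) w).toIdeal := by
    rw [hspan, Ideal.span_le]
    rintro _ ⟨j, rfl⟩
    exact hall (L j) ((MvPolynomial.mem_homogeneousSubmodule 1 _).2 (hhom j))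
      (by rw [← HomogeneousIdeal.mem_iff, hspan]; exact Ideal.subset_span ⟨j, rfl⟩)
  have hwcl : w ∈ closure {v} := by
    rw [closure_singleton_eq_zeroLocus]
    intro f hf
    exact hle hf
  have hvw : v ⤳ w := specializes_iff_mem_closure.2 (by simpa using hwcl)
  have hle' : w ≤ v := Scheme.le_iff_specializes.mpr hvw
  by_cases heq : w = v
  · have h1 := hv.height_eq
    rw [← heq, hw.height_eq] at h1
    exact absurd h1 (by norm_cast; omega)
  · have hlt : w < v := lt_of_le_not_ge hle' fun hge =>
      heq (hvw.antisymm (Scheme.le_iff_specializes.mp hge)).eq.symm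
    have h1 := height_add_one_le hlt
    rw [hv.height_eq, hw.height_eq] at h1
    exact absurd h1 (by norm_cast; omega)

end Planes

/-! ### Strong lines are in the `ℚ`-image of the Gysin map (HI Thm 2.1, step `s = r`) -/

section StrongLines

variable {n : ℕ} {K : Type u} [Field K] {Q C : MvPolynomial (Fin (n + 1)) K}
  [IsIntegral (quadric Q).left] {e : ℕ}

/-- **Strong `r`-planes are positive-integer fractions of Gysin images** (Hirschowitz–Iyer, proof of
Thm. 2.1, step `s = r` via Lemma 2.2: `Γ · Y = a • [L]` for the strong `(r+1)`-plane `Γ ⊇ L`): for a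
strong `r`-plane point `v` of `V₊(Q, C)` there are `a > 0` and a class `x ∈ CH_{r+1}(V₊(Q))` with
`a • [closure v] = quadricCubicGysin x`. [cite: HirschowitzIyer2010, §2 Theorem 2.1 (step s = r) and Lemma 2.2] -/
theorem IsStrongLinePoint.exists_smul_mk_eq_gysin [LocallyOfFiniteType (quadric Q).hom]
    (he : 0 < e) (hC : C ∈ grading (Fin (n + 1)) K e) (hC0 : C ≠ 0)
    (hCη : C ∉ (quadricι Q (genericPoint (quadric Q).left)).asHomogeneousIdeal)
    {r : ℕ} {v : ↥(quadricCubic Q C).left} (hv : IsStrongLinePoint Q C r v) :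
    ∃ (a : ℤ) (x : ChowGroup (quadric Q).left (r + 1)), 0 < a ∧
      a • ChowGroup.ofPoint v hv.1.height_eq = quadricCubicGysin he hC hC0 hCη r x := by
  obtain ⟨hvlin, w, ⟨hw, hcase⟩, hsub⟩ := hv
  set i := quadricCubicToQuadric Q C with hidef
  have hvlin' : IsLinearSubspacePoint r n (completeIntersectionι (fun _ : Fin 1 => Q)) (i.left v) :=
    (isLinearSubspacePoint_quadricCubic_iff v).1 hvlin
  rcases hcase with hPi | ⟨ℓ, hℓ, hℓw, hCℓ⟩
  · -- `Π ⊆ V₊(C)`: cut the line `closure v` out of `Π` by a linear form `m ∉ 𝔭_w`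
    have hvP : IsLinearSubspacePoint r n (𝟙 (projectiveSpace n K)) (quadricι Q (i.left v)) :=
      (isLinearSubspacePoint_iff_base (completeIntersectionι (fun _ : Fin 1 => Q)) (i.left v)).1 hvlin'
    have hwP : IsLinearSubspacePoint (r + 1) n (𝟙 (projectiveSpace n K)) (quadricι Q w) :=
      (isLinearSubspacePoint_iff_base (completeIntersectionι (fun _ : Fin 1 => Q)) w).1 hw
    obtain ⟨m, hm, hmv, hmw⟩ := exists_linear_mem_notMem hvP hwP
    obtain ⟨v', hv', a, ha, hgys, hcl⟩ :=
      quadricCubicGysin_mk_primeCycle_eq_smul_of_subset he hC hC0 hCη hw hPi hm hmw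
    -- `closure v ⊆ Π ∩ V₊(m) = closure v'`, both `r`-planes: `v = v'`
    have hvv' : v = v' := by
      refine eq_of_closure_subset_of_height_eq hvlin.height_eq hv'.height_eq ?_
      rw [hcl]
      refine Set.subset_inter hsub ?_
      refine closure_minimal ?_ (ProjectiveSpectrum.isClosed_zeroLocus _ _)
      exact Set.singleton_subset_iff.2 ((ProjectiveSpectrum.mem_zeroLocus _ _ _).2
        (Set.singleton_subset_iff.2 hmv))
    subst hvv'
    exact ⟨a, QuotientAddGroup.mk ⟨primeCycle w, hw.primeCycle_mem⟩, ha, hgys.symm⟩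
  · -- `Π ∩ V₊(C) = Π ∩ V₊(ℓ)`: `closure v ⊆ Π ∩ V₊(C) = closure v'`
    obtain ⟨v', hv', a, ha, hgys, hcl⟩ :=
      quadricCubicGysin_mk_primeCycle_eq_smul he hC hC0 hCη hw hℓ hℓw hCℓ
    have hvC : closure {quadricι Q (i.left v)} ⊆
        ProjectiveSpectrum.zeroLocus (MvPolynomial.homogeneousSubmodule (Fin (n + 1)) K) {C} := by
      refine closure_minimal ?_ (ProjectiveSpectrum.isClosed_zeroLocus _ _)
      rw [Set.singleton_subset_iff]
      have hr : i.left v ∈ Set.range i.left.base := ⟨v, rfl⟩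
      rw [range_quadricCubicToQuadric_eq he hC hC0 hCη, Set.mem_setOf_eq, cubicSection,
        ProjSpace.avoids_pullbackAvoiding_formDivisor_iff _ he hC hC0, not_not] at hr
      exact (ProjectiveSpectrum.mem_zeroLocus _ _ _).2 (Set.singleton_subset_iff.2 hr)
    have hvv' : v = v' := by
      refine eq_of_closure_subset_of_height_eq hvlin.height_eq hv'.height_eq ?_
      rw [hcl, ← hCℓ]
      exact Set.subset_inter hsub hvC
    subst hvv'
    exact ⟨a, QuotientAddGroup.mk ⟨primeCycle w, hw.primeCycle_mem⟩, ha, hgys.symm⟩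

end StrongLines

/-! ### Theorem 2.1 (`r = 1`) from Lemma 2.2 (`s = 0`) -/

section Assembly

variable {n : ℕ} {K : Type u} [Field K] {Q C : MvPolynomial (Fin (n + 1)) K}
  [IsIntegral (quadric Q).left] {e : ℕ}

/-- The `ℚ`-saturation of the image of a homomorphism `f : A → B` (`{b | ∃ N ≠ 0, N • b ∈ f(A)}`) is a
subgroup. [folklore] -/
def qImage {A B : Type*} [AddCommGroup A] [AddCommGroup B] (f : A →+ B) : AddSubgroup B where
  carrier := {b | ∃ N : ℤ, N ≠ 0 ∧ ∃ a : A, N • b = f a}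
  zero_mem' := ⟨1, one_ne_zero, 0, by simp⟩
  add_mem' := by
    rintro b b' ⟨N, hN, a, ha⟩ ⟨N', hN', a', ha'⟩
    refine ⟨N * N', mul_ne_zero hN hN', N' • a + N • a', ?_⟩
    rw [smul_add, map_add, map_zsmul, map_zsmul, ← ha, ← ha', smul_smul, smul_smul, mul_comm N' N]
  neg_mem' := by
    rintro b ⟨N, hN, a, ha⟩
    exact ⟨N, hN, -a, by rw [smul_neg, map_neg, ha]⟩

/-- Membership in `qImage f` (`Iff.rfl`). [folklore] -/
theorem mem_qImage_iff {A B : Type*} [AddCommGroup A] [AddCommGroup B] (f : A →+ B) (b : B) :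
    b ∈ qImage f ↔ ∃ N : ℤ, N ≠ 0 ∧ ∃ a : A, N • b = f a := Iff.rfl

/-- `qImage f` is saturated: `N • b ∈ qImage f`, `N ≠ 0` implies `b ∈ qImage f`. [folklore] -/
theorem mem_qImage_of_smul_mem {A B : Type*} [AddCommGroup A] [AddCommGroup B] (f : A →+ B) {b : B}
    {N : ℤ} (hN : N ≠ 0) (h : N • b ∈ qImage f) : b ∈ qImage f := by
  obtain ⟨N', hN', a, ha⟩ := h
  exact ⟨N' * N, mul_ne_zero hN' hN, a, by rw [mul_smul, ha]⟩

/-- **Hirschowitz–Iyer, Theorem 2.1 for `r = 1`, from Lemma 2.2 with `s = 0`.** For the pair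
`Y = V₊(Q, C) ⊂ Y' = V₊(Q)` (projective, `V₊(Q)` integral, `V₊(Q) ⊄ V₊(C)`): IF every curve
`W = closure {w} ⊆ Y` satisfies `N • [W] = Γ · Y + Σ cᵢ [Lᵢ]` for some `N ≠ 0`, `Γ ∈ CH₂(Y')` and strong
lines `Lᵢ` (Lemma 2.2, `s = 0 < r = 1`, together with the covering hypothesis of Thm. 2.1 which makes
every curve "spanned by strong `0`-planes"), THEN the Gysin map `CH₂(Y') → CH₁(Y)` is onto after
`⊗ ℚ` — strong lines being in the `ℚ`-image by `IsStrongLinePoint.exists_smul_mk_eq_gysin` (step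
`s = 1`) and `CH₁(Y)` being generated by classes of curves.
[cite: HirschowitzIyer2010, §2 Theorem 2.1 (proof, descending induction on s)] -/
theorem quadricCubicGysin_qsurjective_of_curves [LocallyOfFiniteType (quadric Q).hom]
    (he : 0 < e) (hC : C ∈ grading (Fin (n + 1)) K e) (hC0 : C ≠ 0)
    (hCη : C ∉ (quadricι Q (genericPoint (quadric Q).left)).asHomogeneousIdeal)
    (hcurves : ∀ (w : ↥(quadricCubic Q C).left) (hw : height w = (1 : ℕ)), ∃ N : ℤ, N ≠ 0 ∧
      ∃ (x : ChowGroup (quadric Q).left (1 + 1)) (t : Finset ↥(quadricCubic Q C).left)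
        (ht : ∀ v ∈ t, IsStrongLinePoint Q C 1 v) (c : ↥(quadricCubic Q C).left → ℤ),
        N • ChowGroup.ofPoint w hw =
          quadricCubicGysin he hC hC0 hCη 1 x + ∑ v ∈ t.attach, c v • ChowGroup.ofPoint (v : ↥(quadricCubic Q C).left)
            (ht v v.2).1.height_eq)
    (b : ChowGroup (quadricCubic Q C).left 1) :
    ∃ N : ℤ, N ≠ 0 ∧ ∃ x : ChowGroup (quadric Q).left (1 + 1), N • b = quadricCubicGysin he hC hC0 hCη 1 x := by
  classical
  set G := quadricCubicGysin he hC hC0 hCη 1 with hG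
  -- strong lines, then all curves, lie in the `ℚ`-image
  have hline : ∀ (v : ↥(quadricCubic Q C).left) (hv : IsStrongLinePoint Q C 1 v),
      ChowGroup.ofPoint v hv.1.height_eq ∈ qImage G := by
    intro v hv
    obtain ⟨a, x, ha, hax⟩ := hv.exists_smul_mk_eq_gysin he hC hC0 hCη
    exact ⟨a, ha.ne', x, hax⟩
  have hcurve : ∀ (w : ↥(quadricCubic Q C).left) (hw : height w = (1 : ℕ)),
      ChowGroup.ofPoint w hw ∈ qImage G := by
    intro w hw
    obtain ⟨N, hN, x, t, ht, c, hrel⟩ := hcurves w hw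
    refine mem_qImage_of_smul_mem G hN ?_
    rw [hrel]
    refine (qImage G).add_mem ⟨1, one_ne_zero, x, by simp [hG]⟩ ?_
    exact (qImage G).sum_mem fun v _ => (qImage G).zsmul_mem (hline v (ht v v.2)) _
  -- `b` is the class of a finite combination of curves
  haveI : CompactSpace ↥(quadricCubic Q C).left :=
    (quadricCubicToQuadric Q C).left.isClosedEmbedding.compactSpace
  obtain ⟨⟨z, hz⟩, rfl⟩ := QuotientAddGroup.mk_surjective b
  have hfin : (Function.support z).Finite := by
    simpa using z.locallyFiniteSupport.finite_inter_support_of_isCompact isCompact_univ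
  have hne : ∀ w : {x // x ∈ hfin.toFinset}, z w ≠ 0 := fun w =>
    Function.mem_support.mp (hfin.mem_toFinset.mp w.2)
  have hz' : (⟨z, hz⟩ : ↥(cyclesOfDim (quadricCubic Q C).left 1)) =
      ∑ w ∈ hfin.toFinset.attach, z w • ⟨primeCycle (w : ↥(quadricCubic Q C).left),
        primeCycle_mem_cyclesOfDim (hz w (hne w))⟩ := by
    apply Subtype.ext
    rw [AddSubgroup.val_finsetSum]
    simp only [AddSubgroup.coe_zsmul]
    conv_lhs => rw [CartierDivisor.eq_sum_smul_primeCycle_of_finite z hfin]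
    exact (Finset.sum_attach hfin.toFinset (fun w => z w • primeCycle w)).symm
  have hsum : (QuotientAddGroup.mk ⟨z, hz⟩ : ChowGroup (quadricCubic Q C).left 1) =
      ∑ w ∈ hfin.toFinset.attach, z w • ChowGroup.ofPoint (w : ↥(quadricCubic Q C).left) (hz w (hne w)) := by
    rw [hz', QuotientAddGroup.mk_sum]
    rfl
  change QuotientAddGroup.mk ⟨z, hz⟩ ∈ qImage G
  rw [hsum]
  exact (qImage G).sum_mem fun w _ => (qImage G).zsmul_mem (hcurve w _) _

end Assembly

end Literature.AlgebraicGeometry.Motives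

end
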